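import Summits.QuantumFields.YangMills.Theorems.BalabanUVNodesN16ConstantOfRecord
import Summits.QuantumFields.YangMills.Theorems.BalabanUVNodesN16ShapeKnit
import Summits.QuantumFields.BalabanUV.T4Continuum.Spine.NE3.PairDbarB8
import HarnessLib

/-!
# Route «BalabanUVNodes» (cluster K4 «SpineRates»), Track-A DAG node N16 = NE3 — THE N05 INTERFACE WITH ITS (1.37) MEMBER TRADED FOR
# [B8] THEOREM 4's PRINTED GAUGE RESTRICTION (1.29): N16 from «`LandauRepB8` at every pair ∧ the Landau→pinned-axial transition gauge
# satisfies `Restr129`» ∧ N07's interface, with the constant of record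

Cell `pub-ymgap`, seat `pub-ymgap-dag-n16-a` (KNIT-BY-NAME, HUMAN RULING D-0062; chair R424 venue), generation 3, file 2.  `bears_on: R4∕N16`.  Filed
`--supports stmt-QuantumFields-19182` (`SpineGivenEndpoint`, K4).

WHAT THE N05 INTERFACE OF RECORD SAYS.  `NE3.PairLandauB8Avg.PairLandauGaugeB8Avg d 𝒞 L N b g s₁ s₂ β dom`: at every minimiser pair `(U_A, U_B)` (levels
`k`, `k+1`, same datum, `U_B` `(b,g)`-regular) there are `(u, Z)` with `LandauRepB8Avg L N k W U_A u Z s₁ s₂ β`, `W = rescale L (bavg L U_B)` —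
[Balaban1985RegularSpaces] Thm 2's conclusions READ at the pair: gauge `u` unitary∕periodic, `Z` skew∕periodic, `U_A^{u} = W·e^{Z}`, (1.38) Landau,
(1.36) sup∕gradient∕Hölder, (1.39) rough Laplacian — PLUS the member `dbar` = (1.37) at the pair, `dbavgCovIter L W (relPert W Z) k = 1`.  g0 displayed
that last member as a FRAME CONDITION on the gauge (`BalabanUVNodesN16.n16_of_inEdges_frame`, census R49–R53 «(M1)»).

WHAT THIS FILE DOES.  Seat n16-b's `NE3.PairDbarB8.dbar_of_restr129_pair` (p411?? — tree `Spine/NE3/PairDbarB8.lean`) proved: (1.37) at the pair is FREE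
given [Balaban1985RegularSpaces] THEOREM 4's OWN restriction (1.29) p. 81 («(R₀ū)ʲ(y) = 1 for y ∈ Λ_j», typed `B8Eq119TwistedAxial.Restr129`) on the
transition gauge `u′` from the Landau representative `W·e^{Z}` to the pinned axial pre-gauge `U_A^{u₀}`, `u₀ = B8Eq166ConstraintPair.ptw L W U_A k`
(`(W·e^{Z})^{u′} = U_A^{u₀}`) — pure averaging algebra ([Balaban1985Averaging] (84)∕(87)∕(88)), because the pre-gauge keeps the constraint.  So the N05
interface can be DISPLAYED in Theorem 4's printed OUTPUT vocabulary: per pair, `∃ (u, Z), LandauRepB8 L N k W U_A u Z s₁ s₂ 1 ∧ ∃ u′, (W·e^{Z})^{u′} =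
U_A^{u₀} ∧ Restr129 L k Λ W u′` (`Λ k = univ`: the all-small-field torus, reading (R-a)) — NO (1.37) and NO frame condition among the hypotheses.
§1 `pairLandauGaugeB8Avg_of_restr129`: that display ∧ the [B7]-Prop-4 letter regime ⟹ `PairLandauGaugeB8Avg d (sfClass d L N ε) L N b g s₁ s₂ β dom`
(any `d ≥ 1`).  §2 `restrRegime_of_small`: the letter regime (`α := 2ε`) holds for `0 < ε ≤ r₁₂₉(d, L)`, `0 ≤ b ≤ ε∕2` — four closed radii.
§3 **`n16_of_inEdges_restr129`** (`d = 4`): `∃ r > 0, ∀ g > 0, ∃ C ≥ 0, ∀ b′ c′` (leaf lines) `ε ≤ r, s₁ ≤ r, b ≤ ε∕2, s₂, dom`: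
(N05 displayed as above) → `LeafH3sup 4 L N ε b′ c′ dom` (N07) → `NE3EnergyRateWCov 4 (sfClass 4 L N ε) L N b g C s₁ s₂ dom` — file 1's `n16_constant_of_record`
∘ §1 ∘ §2, the constant of record kept.  §4 **`ne3Shape_of_inEdges_restr129`**: the DECL column too — g2's `BalabanUVNodesN16ShapeKnit.ne3Shape_of_inEdges`
(`T4EtaRateMin.NE3Shape` at Bałaban's readings over `sfClass`) with N05 displayed the same way.

HONEST FRAMING.  Bookkeeping over LANDED theorems by name; NO existence statement is proved here: the displayed N05 hypothesis (Landau representative with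
(1.36)∕(1.38)∕(1.39) AND a transition gauge with (1.29)) is [Balaban1985RegularSpaces] Thm 2∕Thm 4 OUTPUT TYPE at a curved background — NOT proved anywhere
in the tree (n16-b's road: `PairThm4AtB8.concl_of_thm4At_minimisers` takes `Thm4At` as hypothesis); `LeafH3sup` is [Balaban1985Variational] Thm 1 (8)+(10)
TYPE; **N16 ∕ NE3 is NOT discharged**; NODE 00 has not pinned NE3's carriers; count-neutral; one finite four-torus at fixed ε — NOT ℝ⁴, NOT infinite
volume, NOT OS, NOT a mass gap, NOT Clay.  Non-vacuity of the new display is NOT shown here (the flat-stratum witness of g0 has `Z = 0`, `U_A^{u} = W`;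
whether its transition gauge satisfies `Restr129` is not checked) — it implies the old display (§1), whose regime is inhabited (g2 `inEdges_regime_inhabited`).
-/

set_option autoImplicit false

open scoped BigOperators Matrix Matrix.Norms.L2Operator
open NormedSpace

namespace Summit.QuantumFields.YangMills.BalabanUVNodes.N16

open Literature.MathematicalPhysics.QuantumFieldTheory.Balaban1983to89
open B7Prop1Explicit B7Prop2Explicit
open T4AveragingDeficitWall (vary fineAction blockSites)
open T4AveragingDeficitWallBoundary (periodBox)
open T4EtaRateMin (NE3Shape)
open B8Eq119TwistedAxial (Restr129)
open B8Eq166ConstraintPair (ptw)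
open Summit.QuantumFields.BalabanUV.T4Continuum
open MinimalActionSandwich (IsMinimiser)
open MinimalActionRate (Regular sfClass minActReadings)
open MinimalActionRefine (RegularSup gradConst)
open BlockAverageCurrent (curConst)
open NE3EnergyWeightedCovShape (NE3EnergyRateWCov)
open NE3RightInverseSupLetters (frameC)
open NE3.PairLandauB8 (LandauRepB8)
open NE3.PairLandauB8Avg (PairLandauGaugeB8Avg)
open NE3.LeafIndexSockets (LeafH3sup)
open NE3.PairDbarB8 (dbar_of_restr129_pair)

noncomputable section

variable {d : ℕ} {n : Type*} [Fintype n] [DecidableEq n]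

/-! ## §1 The N05 interface from its (1.29)-display -/

/-- **`PairLandauGaugeB8Avg` FROM «`LandauRepB8` ∧ THE TRANSITION GAUGE SATISFIES (1.29)»** (`d ≥ 1`, `L ≥ 2`; class radius `ε ≥ 0`, regularity
`b ≥ 0` with `512(d+1)(d+4)L²b ≤ 1`; one letter `α > ε` with `b + 226(8(d+1)(d+4))²b² < α`, `C₀α ≤ ⅓`, `2α ≤ c₂′` — the [Balaban1985Averaging] Prop. 4 regime of
the pinned axial pre-gauge).  HYPOTHESIS (the N05 interface displayed in [Balaban1985RegularSpaces] Thm 4's printed output vocabulary): at every minimiser pair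
over `sfClass d L N ε` there are `(u, Z)` with `LandauRepB8 L N k W U_A u Z s₁ s₂ β` (`W = rescale L (bavg L U_B)`; gauge, representation `U_A^{u} = W·e^{Z}`,
(1.38), (1.36), (1.39)) and a transition gauge `u′` with `(W·e^{Z})^{u′} = U_A^{u₀}`, `u₀ = ptw L W U_A k` the pinned axial pre-gauge, satisfying (1.29)
`Restr129 L k Λ W u′` for some `Λ` with `Λ k = univ`.  CONCLUSION: `PairLandauGaugeB8Avg d (sfClass d L N ε) L N b g s₁ s₂ β dom` — the member (1.37) `dbar`
supplied by `NE3.PairDbarB8.dbar_of_restr129_pair`.  No existence is proved: the display is Thm 2∕Thm 4 OUTPUT TYPE. [folklore] -/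
theorem pairLandauGaugeB8Avg_of_restr129 [Nonempty n] (hd : 1 ≤ d) {L N : ℕ} (hL : 2 ≤ L) {ε b g α s₁ s₂ β : ℝ}
    (hε : 0 ≤ ε) (hb : 0 ≤ b) (hbs : 512 * (d + 1) * (d + 4) * (L : ℝ) ^ 2 * b ≤ 1) (hα : 0 < α) (hεα : ε < α)
    (hbα : b + 226 * (8 * (d + 1) * (d + 4)) ^ 2 * b ^ 2 < α) (hα3 : C0 d * α ≤ 1 / 3) (hα2 : 2 * α ≤ c2' d L)
    {dom : Set (Site d → Fin d → (Matrix n n ℂ)ˣ)}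
    (hB8 : ∀ k : ℕ, 1 ≤ k → ∀ V ∈ dom, ∀ UA UB : Site d → Fin d → (Matrix n n ℂ)ˣ,
      IsMinimiser d (sfClass d L N ε) L N k V UA → IsMinimiser d (sfClass d L N ε) L N (k + 1) V UB → Regular d L N b g (k + 1) UB →
        ∃ (u : Site d → (Matrix n n ℂ)ˣ) (Z : Site d → Fin d → Matrix n n ℂ),
          LandauRepB8 L N k (rescale L (bavg L UB)) UA u Z s₁ s₂ β ∧
          ∃ u' : Site d → (Matrix n n ℂ)ˣ,
            gaugeAct u' (vary (rescale L (bavg L UB)) Z 1) = gaugeAct (ptw L (rescale L (bavg L UB)) UA k) UA ∧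
            ∃ Λ : ℕ → Set (Site d), Λ k = Set.univ ∧ Restr129 L k Λ (rescale L (bavg L UB)) u') :
    PairLandauGaugeB8Avg d (sfClass d L N ε) L N b g s₁ s₂ β dom := by
  intro k hk V hV UA UB hA hB hreg
  obtain ⟨u, Z, hLR, u', hu', Λ, hΛ, hres⟩ := hB8 k hk V hV UA UB hA hB hreg
  exact ⟨u, Z, hLR, dbar_of_restr129_pair hd hL hA hB hreg hε hb hbs hα hεα hbα hα3 hα2 hu' hΛ hres⟩

/-! ## §2 The letter regime below four closed radii -/

/-- **THE [B7]-PROP-4 LETTER REGIME OF §1 IS MET BELOW FOUR CLOSED RADII** (`L ≥ 1`): for `0 < ε` with `(6C₀(d)+1)ε ≤ 1`, `4ε ≤ c₂′(d,L)`,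
`(226(8(d+1)(d+4))² + 1)ε ≤ 1`, `(256(d+1)(d+4)L² + 1)ε ≤ 1` and `0 ≤ b ≤ ε∕2`, the letter `α := 2ε` satisfies `ε < α`, `b + 226(8(d+1)(d+4))²b² < α`,
`C₀α ≤ ⅓`, `2α ≤ c₂′`, and `512(d+1)(d+4)L²b ≤ 1`. [folklore] -/
theorem restrRegime_of_small (d L : ℕ) {ε b : ℝ} (hε : 0 < ε) (hb : 0 ≤ b) (hbh : b ≤ ε / 2)
    (h1 : (6 * C0 d + 1) * ε ≤ 1) (h2 : 4 * ε ≤ c2' d L)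
    (h3 : (226 * (8 * ((d : ℝ) + 1) * ((d : ℝ) + 4)) ^ 2 + 1) * ε ≤ 1) (h4 : (256 * ((d : ℝ) + 1) * ((d : ℝ) + 4) * (L : ℝ) ^ 2 + 1) * ε ≤ 1) :
    0 < 2 * ε ∧ ε < 2 * ε ∧ b + 226 * (8 * (d + 1) * (d + 4)) ^ 2 * b ^ 2 < 2 * ε ∧ C0 d * (2 * ε) ≤ 1 / 3 ∧ 2 * (2 * ε) ≤ c2' d L ∧
      512 * (d + 1) * (d + 4) * (L : ℝ) ^ 2 * b ≤ 1 := by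
  have hC0 := (C0_pos d).le
  have hK : (0 : ℝ) ≤ 226 * (8 * ((d : ℝ) + 1) * ((d : ℝ) + 4)) ^ 2 := by positivity
  have hM : (0 : ℝ) ≤ 256 * ((d : ℝ) + 1) * ((d : ℝ) + 4) * (L : ℝ) ^ 2 := by positivity
  refine ⟨by linarith, by linarith, ?_, by nlinarith, by linarith, ?_⟩
  · -- `226K²·b² ≤ 226K²·(ε∕2)·b ≤ b∕2`, so `b + 226K²b² ≤ ε∕2 + ε∕4 < 2ε`
    have hKε : 226 * (8 * ((d : ℝ) + 1) * ((d : ℝ) + 4)) ^ 2 * ε ≤ 1 := by nlinarith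
    have hb2 : b ^ 2 ≤ (ε / 2) * b := by rw [sq]; exact mul_le_mul_of_nonneg_right hbh hb
    have hq : 226 * (8 * ((d : ℝ) + 1) * ((d : ℝ) + 4)) ^ 2 * b ^ 2 ≤ b / 2 := by
      calc 226 * (8 * ((d : ℝ) + 1) * ((d : ℝ) + 4)) ^ 2 * b ^ 2
          ≤ 226 * (8 * ((d : ℝ) + 1) * ((d : ℝ) + 4)) ^ 2 * ((ε / 2) * b) := mul_le_mul_of_nonneg_left hb2 hK
        _ = (226 * (8 * ((d : ℝ) + 1) * ((d : ℝ) + 4)) ^ 2 * ε) * b / 2 := by ring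
        _ ≤ 1 * b / 2 := by gcongr
        _ = b / 2 := by ring
    have e : (226 : ℝ) * (8 * (d + 1) * (d + 4)) ^ 2 * b ^ 2 = 226 * (8 * ((d : ℝ) + 1) * ((d : ℝ) + 4)) ^ 2 * b ^ 2 := by ring
    linarith [e]
  · have hMε : 256 * ((d : ℝ) + 1) * ((d : ℝ) + 4) * (L : ℝ) ^ 2 * ε ≤ 1 := by nlinarith
    have e : (512 : ℝ) * (d + 1) * (d + 4) * (L : ℝ) ^ 2 * b = 2 * (256 * ((d : ℝ) + 1) * ((d : ℝ) + 4) * (L : ℝ) ^ 2) * b := by ring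
    rw [e]
    calc 2 * (256 * ((d : ℝ) + 1) * ((d : ℝ) + 4) * (L : ℝ) ^ 2) * b
        ≤ 2 * (256 * ((d : ℝ) + 1) * ((d : ℝ) + 4) * (L : ℝ) ^ 2) * (ε / 2) := mul_le_mul_of_nonneg_left hbh (by positivity)
      _ = 256 * ((d : ℝ) + 1) * ((d : ℝ) + 4) * (L : ℝ) ^ 2 * ε := by ring
      _ ≤ 1 := hMε

/-! ## §3 The `d = 4` knit: N16 with the constant of record from the (1.29)-display of N05 and N07's interface -/

/-- **N16 · NE3 BY NAME FROM ITS IN-EDGES, N05 DISPLAYED WITH (1.29) INSTEAD OF (1.37), CONSTANT OF RECORD KEPT** (`d = 4`; `L ≥ 2`, `N ≥ 1`): there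
is `r > 0` (function of `(L, N, n)`) such that for every `g > 0` there is ONE `C ≥ 0` (function of `(L, N, n, g)`) such that for all leaf letters
`0 ≤ b′, c′` on (Rb) and the `c′`-line, every `0 < ε ≤ r`, `0 ≤ s₁ ≤ r`, `0 ≤ b ≤ ε∕2`, every `s₂` and `dom`: IF at every minimiser pair over
`sfClass 4 L N ε` there are `(u, Z)` with `LandauRepB8 L N k W U_A u Z s₁ s₂ 1` ([Balaban1985RegularSpaces] Thm 2's (1.36)∕(1.38)∕(1.39) read at the
pair) and a transition gauge `u′` to the pinned axial pre-gauge with Thm 4's (1.29) `Restr129 L k Λ W u′` (`Λ k = univ`) — the N05 interface in PRINTED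
output vocabulary — AND `LeafH3sup 4 L N ε b′ c′ dom` (N07, [Balaban1985Variational] Thm 1 (8)+(10) TYPE), THEN `NE3EnergyRateWCov 4 (sfClass 4 L N ε)
L N b g C s₁ s₂ dom` (= `YMDAG.N16 L N ε b g C s₁ s₂ dom`).  File 1's `n16_constant_of_record` ∘ §1 ∘ §2 (`r` shrunk by §2's four radii at `d = 4`).
N16 ∕ NE3 NOT proved: both displayed interfaces are hypotheses. [folklore] -/
theorem n16_of_inEdges_restr129 [Nonempty n] {L N : ℕ} (hL : 2 ≤ L) (hN : 1 ≤ N) :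
    ∃ r : ℝ, 0 < r ∧ ∀ ⦃g : ℝ⦄, 0 < g → ∃ C : ℝ, 0 ≤ C ∧ ∀ ⦃b' c' : ℝ⦄, 0 ≤ b' → 0 ≤ c' →
      2 ^ 15 * ((4 : ℝ) + 1) ^ 2 * ((4 : ℝ) + 4) ^ 2 * (L : ℝ) ^ 2 * b' ≤ 1 →
      23040 * (4 : ℝ) ^ 4 * (frameC 4 L + 4) ^ 3 * (c' + curConst 4 L * b' ^ 2) ≤ 1 →
      ∀ ⦃ε s₁ b : ℝ⦄, 0 < ε → ε ≤ r → 0 ≤ s₁ → s₁ ≤ r → 0 ≤ b → b ≤ ε / 2 →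
      ∀ (s₂ : ℝ) {dom : _root_.Set (Site 4 → Fin 4 → (Matrix n n ℂ)ˣ)},
        (∀ k : ℕ, 1 ≤ k → ∀ V ∈ dom, ∀ UA UB : Site 4 → Fin 4 → (Matrix n n ℂ)ˣ,
          IsMinimiser 4 (sfClass 4 L N ε) L N k V UA → IsMinimiser 4 (sfClass 4 L N ε) L N (k + 1) V UB → Regular 4 L N b g (k + 1) UB →
            ∃ (u : Site 4 → (Matrix n n ℂ)ˣ) (Z : Site 4 → Fin 4 → Matrix n n ℂ),
              LandauRepB8 L N k (rescale L (bavg L UB)) UA u Z s₁ s₂ 1 ∧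
              ∃ u' : Site 4 → (Matrix n n ℂ)ˣ,
                gaugeAct u' (vary (rescale L (bavg L UB)) Z 1) = gaugeAct (ptw L (rescale L (bavg L UB)) UA k) UA ∧
                ∃ Λ : ℕ → Set (Site 4), Λ k = Set.univ ∧ Restr129 L k Λ (rescale L (bavg L UB)) u') →
        LeafH3sup 4 L N ε b' c' dom →
        NE3EnergyRateWCov 4 (sfClass 4 L N ε) L N b g C s₁ s₂ dom := by
  have hL1 : 1 ≤ L := by omega
  obtain ⟨r, hr0, hr⟩ := n16_constant_of_record (n := n) hL hN
  -- §2's four radii at `d = 4`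
  have hc2 : 0 < c2' 4 L := c2'_pos 4 L hL1
  have hC0 := (C0_pos 4).le
  obtain ⟨R₁, hR₁⟩ : ∃ R : ℝ, R = 1 / (6 * C0 4 + 1) := ⟨_, rfl⟩
  obtain ⟨R₃, hR₃⟩ : ∃ R : ℝ, R = 1 / (226 * (8 * ((4 : ℝ) + 1) * ((4 : ℝ) + 4)) ^ 2 + 1) := ⟨_, rfl⟩
  obtain ⟨R₄, hR₄⟩ : ∃ R : ℝ, R = 1 / (256 * ((4 : ℝ) + 1) * ((4 : ℝ) + 4) * (L : ℝ) ^ 2 + 1) := ⟨_, rfl⟩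
  have hR₁0 : 0 < R₁ := by rw [hR₁]; positivity
  have hR₃0 : 0 < R₃ := by rw [hR₃]; positivity
  have hR₄0 : 0 < R₄ := by rw [hR₄]; positivity
  refine ⟨min r (min R₁ (min (c2' 4 L / 4) (min R₃ R₄))), lt_min hr0 (lt_min hR₁0 (lt_min (by positivity) (lt_min hR₃0 hR₄0))),
    fun g hg => ?_⟩
  obtain ⟨C, hC0', hC⟩ := hr hg
  refine ⟨C, hC0', fun b' c' hb' hc' hRb hcF ε s₁ b hε hεr hs₁ hs₁r hb hbh s₂ dom hB8 h3 => ?_⟩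
  have hεr' : ε ≤ r := hεr.trans (min_le_left _ _)
  have hε1 : ε ≤ R₁ := hεr.trans ((min_le_right _ _).trans (min_le_left _ _))
  have hε2 : ε ≤ c2' 4 L / 4 := hεr.trans ((min_le_right _ _).trans ((min_le_right _ _).trans (min_le_left _ _)))
  have hε3 : ε ≤ R₃ := hεr.trans ((min_le_right _ _).trans ((min_le_right _ _).trans ((min_le_right _ _).trans (min_le_left _ _))))
  have hε4 : ε ≤ R₄ := hεr.trans ((min_le_right _ _).trans ((min_le_right _ _).trans ((min_le_right _ _).trans (min_le_right _ _))))
  have hs₁r' : s₁ ≤ r := hs₁r.trans (min_le_left _ _)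
  have h1 : (6 * C0 4 + 1) * ε ≤ 1 := by
    rw [hR₁, le_div_iff₀ (by positivity)] at hε1; linarith
  have h2 : 4 * ε ≤ c2' 4 L := by linarith
  have h3' : (226 * (8 * (((4 : ℕ) : ℝ) + 1) * (((4 : ℕ) : ℝ) + 4)) ^ 2 + 1) * ε ≤ 1 := by
    rw [hR₃, le_div_iff₀ (by positivity)] at hε3; push_cast; linarith
  have h4' : (256 * (((4 : ℕ) : ℝ) + 1) * (((4 : ℕ) : ℝ) + 4) * (L : ℝ) ^ 2 + 1) * ε ≤ 1 := by
    rw [hR₄, le_div_iff₀ (by positivity)] at hε4; push_cast; linarith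
  obtain ⟨hα, hεα, hbα, hα3, hα2, hbs⟩ := restrRegime_of_small 4 L hε hb hbh h1 h2 h3' h4'
  exact hC hb' hc' hRb hcF hε hεr' hs₁ hs₁r' hb hbh s₂ (pairLandauGaugeB8Avg_of_restr129 (by norm_num) hL hε.le hb hbs hα hεα hbα hα3 hα2 hB8) h3

/-! ## §4 The DECL column too: `NE3Shape` at Bałaban's readings from the (1.29)-display of N05 and N07's interface -/

/-- **N16 · THE ROW's DECL `T4EtaRateMin.NE3Shape` FROM THE (1.29)-DISPLAY OF N05 ∧ N07's INTERFACE** (`d = 4`; `L ≥ 2`, `N ≥ 1`) — g2's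
`BalabanUVNodesN16ShapeKnit.ne3Shape_of_inEdges` verbatim (numeric regime: `0 < ε ≤ r`, `0 ≤ s₁ ≤ r`, `0 ≤ b ≤ t`, `0 < c ≤ t`, `2^91·L^17·t ≤ 1`,
`2^76·L^12·t ≤ ε`, `16·C₀(4)·ε ≤ 3`, `1024·5·8·L²·ε ≤ 1`, `b ≤ ε∕2`, the `c`-line, data radius `ε₁ ≤ 1∕4`, `ε₁ ≤ b`, `4ε₁ ≤ c`, `dom ⊆ sfClass 4 L N ε₁ 0`;
`r` shrunk by §2's four radii) but with the N05 interface DISPLAYED as in §1∕§3 at `g := gradConst 4 c`: «`LandauRepB8` at every pair ∧ a transition gauge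
with (1.29)» — no (1.37), no frame condition.  CONCLUSION unchanged: a regular selection of minimisers exists, and for every such selection `∃ C′ ≥ 0,
NE3Shape (minActReadings 4 (sfClass 4 L N ε) L N dom loc_D) C′ (L⁻¹)`.  N16 ∕ NE3 NOT proved: both displayed interfaces are hypotheses. [folklore] -/
theorem ne3Shape_of_inEdges_restr129 [Nonempty n] {L N : ℕ} (hL : 2 ≤ L) (hN : 1 ≤ N) :
    ∃ r : ℝ, 0 < r ∧ ∀ ⦃ε s₁ t b c ε₁ : ℝ⦄, 0 < ε → ε ≤ r → 0 ≤ s₁ → s₁ ≤ r →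
      0 ≤ b → b ≤ t → 0 < c → c ≤ t →
      (2 : ℝ) ^ 91 * (L : ℝ) ^ 17 * t ≤ 1 → (2 : ℝ) ^ 76 * (L : ℝ) ^ 12 * t ≤ ε →
      16 * C0 4 * ε ≤ 3 → 1024 * (4 + 1) * (4 + 4) * (L : ℝ) ^ 2 * ε ≤ 1 → b ≤ ε / 2 →
      23040 * (4 : ℝ) ^ 4 * (frameC 4 L + 4) ^ 3 * (c + curConst 4 L * b ^ 2) ≤ 1 →
      ε₁ ≤ 1 / 4 → ε₁ ≤ b → 4 * ε₁ ≤ c →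
      ∀ (s₂ : ℝ) {dom : Set (Site 4 → Fin 4 → (Matrix n n ℂ)ˣ)}, dom ⊆ sfClass 4 L N ε₁ 0 →
        (∀ k : ℕ, 1 ≤ k → ∀ V ∈ dom, ∀ UA UB : Site 4 → Fin 4 → (Matrix n n ℂ)ˣ,
          IsMinimiser 4 (sfClass 4 L N ε) L N k V UA → IsMinimiser 4 (sfClass 4 L N ε) L N (k + 1) V UB →
          Regular 4 L N b (gradConst 4 c) (k + 1) UB →
            ∃ (u : Site 4 → (Matrix n n ℂ)ˣ) (Z : Site 4 → Fin 4 → Matrix n n ℂ),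
              LandauRepB8 L N k (rescale L (bavg L UB)) UA u Z s₁ s₂ 1 ∧
              ∃ u' : Site 4 → (Matrix n n ℂ)ˣ,
                gaugeAct u' (vary (rescale L (bavg L UB)) Z 1) = gaugeAct (ptw L (rescale L (bavg L UB)) UA k) UA ∧
                ∃ Λ : ℕ → Set (Site 4), Λ k = Set.univ ∧ Restr129 L k Λ (rescale L (bavg L UB)) u') →
        LeafH3sup 4 L N ε b c dom →
        (∃ sel : ℕ → (Site 4 → Fin 4 → (Matrix n n ℂ)ˣ) → (Site 4 → Fin 4 → (Matrix n n ℂ)ˣ),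
            ∀ V ∈ dom, ∀ k : ℕ, IsMinimiser 4 (sfClass 4 L N ε) L N k V (sel k V) ∧ RegularSup 4 L N b c k (sel k V)) ∧
        ∀ sel : ℕ → (Site 4 → Fin 4 → (Matrix n n ℂ)ˣ) → (Site 4 → Fin 4 → (Matrix n n ℂ)ˣ),
          (∀ V ∈ dom, ∀ k : ℕ, IsMinimiser 4 (sfClass 4 L N ε) L N k V (sel k V)) →
          (∀ V ∈ dom, ∀ k : ℕ, RegularSup 4 L N b c k (sel k V)) →
          ∃ C' : ℝ, 0 ≤ C' ∧
            NE3Shape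
              (minActReadings 4 (sfClass 4 L N ε) L N dom
                (fun k V (x : ↥(periodBox (d := 4) N)) =>
                  fineAction (sel k V) (((blockSites L)^[k] {(x : Site 4)}) ×ˢ Finset.univ)))
              C' ((L : ℝ)⁻¹) := by
  have hL1 : 1 ≤ L := by omega
  obtain ⟨r, hr0, hr⟩ := ne3Shape_of_inEdges (n := n) hL hN
  have hc2 : 0 < c2' 4 L := c2'_pos 4 L hL1
  have hC0 := (C0_pos 4).le
  obtain ⟨R₁, hR₁⟩ : ∃ R : ℝ, R = 1 / (6 * C0 4 + 1) := ⟨_, rfl⟩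
  obtain ⟨R₃, hR₃⟩ : ∃ R : ℝ, R = 1 / (226 * (8 * ((4 : ℝ) + 1) * ((4 : ℝ) + 4)) ^ 2 + 1) := ⟨_, rfl⟩
  obtain ⟨R₄, hR₄⟩ : ∃ R : ℝ, R = 1 / (256 * ((4 : ℝ) + 1) * ((4 : ℝ) + 4) * (L : ℝ) ^ 2 + 1) := ⟨_, rfl⟩
  have hR₁0 : 0 < R₁ := by rw [hR₁]; positivity
  have hR₃0 : 0 < R₃ := by rw [hR₃]; positivity
  have hR₄0 : 0 < R₄ := by rw [hR₄]; positivity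
  refine ⟨min r (min R₁ (min (c2' 4 L / 4) (min R₃ R₄))), lt_min hr0 (lt_min hR₁0 (lt_min (by positivity) (lt_min hR₃0 hR₄0))),
    fun ε s₁ t b c ε₁ hε hεr hs₁ hs₁r hb hbt hc hct hsmall hεt hε1 hε2 hbε hcF hε₁ hε₁b hε₁c s₂ dom hdom hB8 h3 => ?_⟩
  have hεr' : ε ≤ r := hεr.trans (min_le_left _ _)
  have hεR1 : ε ≤ R₁ := hεr.trans ((min_le_right _ _).trans (min_le_left _ _))
  have hεR2 : ε ≤ c2' 4 L / 4 := hεr.trans ((min_le_right _ _).trans ((min_le_right _ _).trans (min_le_left _ _)))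
  have hεR3 : ε ≤ R₃ := hεr.trans ((min_le_right _ _).trans ((min_le_right _ _).trans ((min_le_right _ _).trans (min_le_left _ _))))
  have hεR4 : ε ≤ R₄ := hεr.trans ((min_le_right _ _).trans ((min_le_right _ _).trans ((min_le_right _ _).trans (min_le_right _ _))))
  have hs₁r' : s₁ ≤ r := hs₁r.trans (min_le_left _ _)
  have h1 : (6 * C0 4 + 1) * ε ≤ 1 := by
    rw [hR₁, le_div_iff₀ (by positivity)] at hεR1; linarith
  have h2 : 4 * ε ≤ c2' 4 L := by linarith
  have h3' : (226 * (8 * (((4 : ℕ) : ℝ) + 1) * (((4 : ℕ) : ℝ) + 4)) ^ 2 + 1) * ε ≤ 1 := by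
    rw [hR₃, le_div_iff₀ (by positivity)] at hεR3; push_cast; linarith
  have h4' : (256 * (((4 : ℕ) : ℝ) + 1) * (((4 : ℕ) : ℝ) + 4) * (L : ℝ) ^ 2 + 1) * ε ≤ 1 := by
    rw [hR₄, le_div_iff₀ (by positivity)] at hεR4; push_cast; linarith
  obtain ⟨hα, hεα, hbα, hα3, hα2, hbs⟩ := restrRegime_of_small 4 L hε hb hbε h1 h2 h3' h4'
  exact hr hε hεr' hs₁ hs₁r' hb hbt hc hct hsmall hεt hε1 hε2 hbε hcF hε₁ hε₁b hε₁c s₂ hdom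
    (pairLandauGaugeB8Avg_of_restr129 (by norm_num) hL hε.le hb hbs hα hεα hbα hα3 hα2 hB8) h3

end

end Summit.QuantumFields.YangMills.BalabanUVNodes.N16
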